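import Mathlib
import Literature.Analysis.FluidPDE.GaussianVortexPlanar
import Literature.Analysis.FluidPDE.GaussianVortexPlanarProofs
import Literature.Analysis.FluidPDE.BiotSavart2DSymmetry
import Summits.AnomalousDissipation.AnomalousDissipation.Theorems.MarginalStabilityChainStretchedVortexRowsStubCoreRotationLocalSkew
import Summits.AnomalousDissipation.AnomalousDissipation.Theorems.MarginalStabilityChainStretchedVortexRowsStubBiotSavartFarField
import Summits.AnomalousDissipation.AnomalousDissipation.Theorems.MarginalStabilityChainStretchedVortexRowsStubBiotSavartYoung
import Summits.AnomalousDissipation.AnomalousDissipation.Theorems.MarginalStabilityChainStretchedVortexRowsStubLamBPairingDtheta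
import HarnessLib

/-!
# Tools for the helper `lamB_pairing_w_bound` toward stub `stub_coreInverse` of the line
# `braid-closed-large-circulation-gluing` (crux stmt-AnomalousDissipation-3009, `MarginalStabilityChain.StretchedVortexRows`)

The background pairing `⟨Λ_B w, w⟩_{L²(G⁻¹)}`, `Λ_B w = (K∗w)·∇w_B + (K∗w_B)·∇w`, of the energy method for
`stub_coreInverse` is controlled by the ANGULAR energy `Θ = ∫ G⁻¹Ω(∂_θw)²` only through the circular-mean
decomposition `u = u₀ + u_⊥` of `w = G u` (`G = (4π)⁻¹e^{−|ξ|²/4}`, `Ω = (8π)⁻¹φ(|ξ|²/4)` the angular velocity of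
the Gaussian vortex, `K(z) = z^⊥/(2π|z|²)`). This file provides the two quantitative tools for the blocks of the
gradient half `∫ u ⟪K∗(Gu), ∇w_B⟫` that contain a non-radial factor:

* `biotSavart2D_gauss_mul_sq_integral_le` — **Young's inequality in ground-state variables**: for every `n`,
  `∫ ‖K∗(Gv)‖² (1+|ξ|)ⁿ G ≤ C(n) ∫ G Ω v²` for bounded continuous `v`. From the landed Young-type bound
  `∫ ‖K∗w‖² h² ≤ C (H² ∫ w² + ‖w‖₁² ∫ h²)` (`…StubBiotSavartYoung`) with `w = Gv`, `h² = (1+|ξ|)ⁿG`, and the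
  lower bound `1 ≤ 8π(1+|ξ|)²Ω` (`one_le_mul_sq_mul_omegaWeight`), which gives `w² = G²v² ≤ 8πB₂ · GΩv²` and
  `‖w‖₁² ≤ 8π (∫(1+|ξ|)²G) ∫ GΩv²` (`B₂ = sup (1+|ξ|)²G`);
* `lamB_w_gradient_block` — **the generic block estimate**
  `|∫ a ⟪K∗(Gv), ∇w_B⟫| ≤ c(k, C_B) (∫ GΩa²)^{1/2} (∫ GΩv²)^{1/2}` for bounded continuous `a, v` and
  `‖∇w_B‖ ≤ C_B(1+|ξ|)^k G`: pointwise `(a⟪K∗(Gv), ∇w_B⟫)² ≤ [8πC_B²‖K∗(Gv)‖²(1+|ξ|)^{2k+2}G]·[GΩa²]`, then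
  Cauchy–Schwarz (`integrable_and_abs_integral_le_of_sq_le_mul`) and the first tool.

Applied with `(a, v) = (u₀, u − u₀)` and `(u − u₀, u)` — the block `(u₀, u₀)` vanishes (`lamB_radial_block_eq_zero`)
— and Wirtinger's inequality on circles `∫ GΩ(u − u₀)² ≤ ¼ ∫ GΩ(∂_θu)²` (`circAvg_wirtinger_even`), these give
`|∫ u⟪K∗(Gu), ∇w_B⟫| ≤ C (∫Gu²)^{1/2} Θ^{1/2}`.

References: Th. Gallay, C. E. Wayne, Comm. Math. Phys. 255 (2005) §4.1 (radial/non-radial decomposition in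
`L²(G⁻¹)`); the estimates are elementary (folklore).
-/

set_option linter.dupNamespace false

noncomputable section

open scoped RealInnerProductSpace Topology
open MeasureTheory WithLp Function Metric Filter Set

namespace Summit.AnomalousDissipation.AnomalousDissipation.Theorems.MarginalStabilityChainStretchedVortexRows

open Literature.Analysis.FluidPDE

/-- **Young's inequality for the Biot–Savart velocity in ground-state variables**: for every `n : ℕ` there is
`C = C(n) ≥ 0` such that `∫ ‖K∗(Gv)‖² (1+|ξ|)ⁿ G ≤ C ∫ G Ω v²` for every bounded continuous `v`
(`w = Gv` has `∫ w² ≤ 8πB₂ ∫GΩv²` and `‖w‖₁² ≤ 8π(∫(1+|ξ|)²G) ∫GΩv²` since `1 ≤ 8π(1+|ξ|)²Ω`). [folklore] -/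
theorem biotSavart2D_gauss_mul_sq_integral_le (n : ℕ) :
    ∃ C : ℝ, 0 ≤ C ∧ ∀ v : EuclideanSpace ℝ (Fin 2) → ℝ, Continuous v → (∃ A : ℝ, ∀ ξ, |v ξ| ≤ A) →
      Integrable (fun ξ => ‖biotSavart2D (fun η => gaussVortexProfile η * v η) ξ‖ ^ 2 *
          ((1 + ‖ξ‖) ^ n * gaussVortexProfile ξ)) ∧
        ∫ ξ, ‖biotSavart2D (fun η => gaussVortexProfile η * v η) ξ‖ ^ 2 *
            ((1 + ‖ξ‖) ^ n * gaussVortexProfile ξ) ≤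
          C * ∫ ξ, gaussVortexProfile ξ * ((8 * Real.pi)⁻¹ * burgersPhi (‖ξ‖ ^ 2 / 4)) * v ξ ^ 2 := by
  obtain ⟨C_Y, hCY0, hCY⟩ := biotSavart2D_mul_sq_integral_le
  obtain ⟨Bn, hBn0, hBn⟩ := exists_bound_one_add_norm_pow_mul_gaussVortexProfile n
  obtain ⟨B₂, hB₂0, hB₂⟩ := exists_bound_one_add_norm_pow_mul_gaussVortexProfile 2
  set Mn : ℝ := ∫ η : EuclideanSpace ℝ (Fin 2), (1 + ‖η‖) ^ n * gaussVortexProfile η with hMn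
  set M₂ : ℝ := ∫ η : EuclideanSpace ℝ (Fin 2), (1 + ‖η‖) ^ 2 * gaussVortexProfile η with hM₂
  have hMn0 : 0 ≤ Mn := integral_nonneg fun η => mul_nonneg (by positivity) (gaussVortexProfile_pos η).le
  have hM₂0 : 0 ≤ M₂ := integral_nonneg fun η => mul_nonneg (by positivity) (gaussVortexProfile_pos η).le
  refine ⟨C_Y * (Bn * (8 * Real.pi * B₂) + 8 * Real.pi * M₂ * Mn), by positivity, ?_⟩
  rintro v hv ⟨A, hA⟩
  have hGpos : ∀ ξ : EuclideanSpace ℝ (Fin 2), 0 < gaussVortexProfile ξ := gaussVortexProfile_pos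
  have hGc : Continuous gaussVortexProfile := (contDiff_gaussVortexProfile (n := 0)).continuous
  have hΩc : Continuous fun ξ : EuclideanSpace ℝ (Fin 2) => (8 * Real.pi)⁻¹ * burgersPhi (‖ξ‖ ^ 2 / 4) :=
    continuous_const.mul ((contDiff_burgersPhi (n := 0)).continuous.comp ((continuous_norm.pow 2).div_const 4))
  have hΩ0 : ∀ ξ : EuclideanSpace ℝ (Fin 2), 0 < (8 * Real.pi)⁻¹ * burgersPhi (‖ξ‖ ^ 2 / 4) := fun ξ =>
    mul_pos (by positivity) (burgersPhi_pos _)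
  have hΩ1 : ∀ ξ : EuclideanSpace ℝ (Fin 2), (8 * Real.pi)⁻¹ * burgersPhi (‖ξ‖ ^ 2 / 4) ≤ (8 * Real.pi)⁻¹ :=
    fun ξ => mul_le_of_le_one_right (by positivity) (burgersPhi_le_one (by positivity))
  -- the vorticity `w = G v`
  set w : EuclideanSpace ℝ (Fin 2) → ℝ := fun η => gaussVortexProfile η * v η with hw
  have hwc : Continuous w := hGc.mul hv
  have hwi : Integrable w := by
    refine integrable_of_le_one_add_norm_pow_mul_gauss hwc (A := A) (N := 0) fun η => ?_
    rw [Real.norm_eq_abs, pow_zero, one_mul, show w η = gaussVortexProfile η * v η from rfl, abs_mul,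
      abs_of_pos (hGpos η), mul_comm]
    exact mul_le_mul_of_nonneg_right (hA η) (hGpos η).le
  -- the comparison weight `Q = G Ω v²`: integrable, and `w² ≤ 8π (1+|ξ|)²G · Q`
  have hQ0 : ∀ ξ : EuclideanSpace ℝ (Fin 2),
      0 ≤ gaussVortexProfile ξ * ((8 * Real.pi)⁻¹ * burgersPhi (‖ξ‖ ^ 2 / 4)) * v ξ ^ 2 := fun ξ =>
    mul_nonneg (mul_nonneg (hGpos ξ).le (hΩ0 ξ).le) (sq_nonneg _)
  have hq : Integrable fun ξ => gaussVortexProfile ξ * ((8 * Real.pi)⁻¹ * burgersPhi (‖ξ‖ ^ 2 / 4)) * v ξ ^ 2 := by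
    refine integrable_of_le_one_add_norm_pow_mul_gauss ((hGc.mul hΩc).mul (hv.pow 2))
      (A := (8 * Real.pi)⁻¹ * A ^ 2) (N := 0) fun ξ => ?_
    rw [Real.norm_of_nonneg (hQ0 ξ), pow_zero, one_mul]
    have hv2 : v ξ ^ 2 ≤ A ^ 2 := by rw [← sq_abs]; exact pow_le_pow_left₀ (abs_nonneg _) (hA ξ) 2
    have h1 := mul_le_mul (hΩ1 ξ) hv2 (sq_nonneg _) (by positivity : (0:ℝ) ≤ (8 * Real.pi)⁻¹)
    calc gaussVortexProfile ξ * ((8 * Real.pi)⁻¹ * burgersPhi (‖ξ‖ ^ 2 / 4)) * v ξ ^ 2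
        = gaussVortexProfile ξ * ((8 * Real.pi)⁻¹ * burgersPhi (‖ξ‖ ^ 2 / 4) * v ξ ^ 2) := by ring
      _ ≤ gaussVortexProfile ξ * ((8 * Real.pi)⁻¹ * A ^ 2) := mul_le_mul_of_nonneg_left h1 (hGpos ξ).le
      _ = (8 * Real.pi)⁻¹ * A ^ 2 * gaussVortexProfile ξ := by ring
  have hkey : ∀ ξ, w ξ ^ 2 ≤ 8 * Real.pi * ((1 + ‖ξ‖) ^ 2 * gaussVortexProfile ξ) *
      (gaussVortexProfile ξ * ((8 * Real.pi)⁻¹ * burgersPhi (‖ξ‖ ^ 2 / 4)) * v ξ ^ 2) := by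
    intro ξ
    calc w ξ ^ 2 ≤ w ξ ^ 2 * (8 * Real.pi * (1 + ‖ξ‖) ^ 2 * ((8 * Real.pi)⁻¹ * burgersPhi (‖ξ‖ ^ 2 / 4))) :=
          le_mul_of_one_le_right (sq_nonneg _) (one_le_mul_sq_mul_omegaWeight ξ)
      _ = _ := by rw [show w ξ = gaussVortexProfile ξ * v ξ from rfl]; ring
  have hkey' : ∀ ξ, w ξ ^ 2 ≤ 8 * Real.pi * B₂ *
      (gaussVortexProfile ξ * ((8 * Real.pi)⁻¹ * burgersPhi (‖ξ‖ ^ 2 / 4)) * v ξ ^ 2) := fun ξ =>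
    (hkey ξ).trans (mul_le_mul_of_nonneg_right (mul_le_mul_of_nonneg_left (hB₂ ξ) (by positivity)) (hQ0 ξ))
  have hw2 : Integrable fun η => w η ^ 2 :=
    (hq.const_mul (8 * Real.pi * B₂)).mono' (hwc.pow 2).aestronglyMeasurable
      (Eventually.of_forall fun ξ => by rw [Real.norm_of_nonneg (sq_nonneg _)]; exact hkey' ξ)
  have hw2le : ∫ η, w η ^ 2 ≤ 8 * Real.pi * B₂ *
      ∫ ξ, gaussVortexProfile ξ * ((8 * Real.pi)⁻¹ * burgersPhi (‖ξ‖ ^ 2 / 4)) * v ξ ^ 2 := by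
    rw [← integral_const_mul]
    exact integral_mono hw2 (hq.const_mul _) hkey'
  have hCS₁ := integrable_and_abs_integral_le_of_sq_le_mul (r := fun ξ => |w ξ|)
    (p := fun ξ => 8 * Real.pi * ((1 + ‖ξ‖) ^ 2 * gaussVortexProfile ξ))
    (continuous_abs.comp hwc).aestronglyMeasurable
    ((integrable_one_add_norm_pow_mul_gaussVortexProfile 2).const_mul _) hq
    (fun ξ => mul_nonneg (by positivity) (mul_nonneg (by positivity) (hGpos ξ).le)) hQ0
    (fun ξ => by rw [sq_abs]; exact hkey ξ)
  have hw1le : (∫ ξ, |w ξ|) ^ 2 ≤ 8 * Real.pi * M₂ *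
      ∫ ξ, gaussVortexProfile ξ * ((8 * Real.pi)⁻¹ * burgersPhi (‖ξ‖ ^ 2 / 4)) * v ξ ^ 2 := by
    have h := hCS₁.2
    rw [integral_const_mul, abs_of_nonneg (integral_nonneg fun ξ => abs_nonneg _)] at h
    have h2 := pow_le_pow_left₀ (integral_nonneg fun ξ => abs_nonneg _) h 2
    rwa [mul_pow, Real.sq_sqrt (by positivity), Real.sq_sqrt (integral_nonneg hQ0)] at h2
  -- the weight `h = ((1+|ξ|)ⁿ G)^{1/2}`
  set h : EuclideanSpace ℝ (Fin 2) → ℝ := fun ξ => Real.sqrt ((1 + ‖ξ‖) ^ n * gaussVortexProfile ξ) with hh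
  have hh2 : ∀ ξ, h ξ ^ 2 = (1 + ‖ξ‖) ^ n * gaussVortexProfile ξ := fun ξ =>
    Real.sq_sqrt (mul_nonneg (by positivity) (hGpos ξ).le)
  have hhc : Continuous h :=
    Real.continuous_sqrt.comp (((continuous_const.add continuous_norm).pow _).mul hGc)
  have hhH : ∀ ξ, |h ξ| ≤ Real.sqrt Bn := fun ξ => by
    rw [abs_of_nonneg (Real.sqrt_nonneg _)]
    exact Real.sqrt_le_sqrt (hBn ξ)
  have hh2i : Integrable (fun ξ => h ξ ^ 2) := by
    simp_rw [hh2]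
    exact integrable_one_add_norm_pow_mul_gaussVortexProfile n
  obtain ⟨hpi, hple⟩ := hCY w h (Real.sqrt Bn) hwc hwi hw2 hhc.aestronglyMeasurable hhH hh2i
  simp_rw [hh2] at hpi hple
  rw [Real.sq_sqrt hBn0] at hple
  refine ⟨hpi, hple.trans ?_⟩
  have e1 := mul_le_mul_of_nonneg_left hw2le hBn0
  have e2 := mul_le_mul_of_nonneg_right hw1le hMn0
  calc C_Y * (Bn * (∫ η, w η ^ 2) + (∫ η, |w η|) ^ 2 * Mn)
      ≤ C_Y * (Bn * (8 * Real.pi * B₂ *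
            ∫ ξ, gaussVortexProfile ξ * ((8 * Real.pi)⁻¹ * burgersPhi (‖ξ‖ ^ 2 / 4)) * v ξ ^ 2) +
          8 * Real.pi * M₂ *
            (∫ ξ, gaussVortexProfile ξ * ((8 * Real.pi)⁻¹ * burgersPhi (‖ξ‖ ^ 2 / 4)) * v ξ ^ 2) * Mn) :=
        mul_le_mul_of_nonneg_left (add_le_add e1 e2) hCY0.le
    _ = C_Y * (Bn * (8 * Real.pi * B₂) + 8 * Real.pi * M₂ * Mn) *
          ∫ ξ, gaussVortexProfile ξ * ((8 * Real.pi)⁻¹ * burgersPhi (‖ξ‖ ^ 2 / 4)) * v ξ ^ 2 := by ring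

/-- **The generic block of the gradient half of `⟨Λ_B w, w⟩`**: there is `c = c(k, C_B) ≥ 0` such that for every
`w_B` with continuous gradient, `‖∇w_B‖ ≤ C_B(1+|ξ|)^k G`, and all bounded continuous `a, v`,
`a ⟪K∗(Gv), ∇w_B⟫ ∈ L¹` and `|∫ a ⟪K∗(Gv), ∇w_B⟫| ≤ c (∫GΩa²)^{1/2} (∫GΩv²)^{1/2}`
(pointwise `(a⟪K∗(Gv), ∇w_B⟫)² ≤ [8πC_B²‖K∗(Gv)‖²(1+|ξ|)^{2k+2}G]·[GΩa²]`, Cauchy–Schwarz, Young). [folklore] -/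
theorem lamB_w_gradient_block :
    ∀ (k : ℕ) (C_B : ℝ), ∃ c : ℝ, 0 ≤ c ∧ ∀ (wB a v : EuclideanSpace ℝ (Fin 2) → ℝ), Continuous (gradient wB) →
      (∀ ξ, ‖gradient wB ξ‖ ≤ C_B * (1 + ‖ξ‖) ^ k * gaussVortexProfile ξ) →
      Continuous a → Continuous v → (∃ A : ℝ, ∀ ξ, |a ξ| ≤ A ∧ |v ξ| ≤ A) →
      Integrable (fun ξ => a ξ * ⟪biotSavart2D (fun η => gaussVortexProfile η * v η) ξ, gradient wB ξ⟫) ∧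
        |∫ ξ, a ξ * ⟪biotSavart2D (fun η => gaussVortexProfile η * v η) ξ, gradient wB ξ⟫| ≤
          c * Real.sqrt (∫ ξ, gaussVortexProfile ξ * ((8 * Real.pi)⁻¹ * burgersPhi (‖ξ‖ ^ 2 / 4)) * a ξ ^ 2) *
            Real.sqrt (∫ ξ, gaussVortexProfile ξ * ((8 * Real.pi)⁻¹ * burgersPhi (‖ξ‖ ^ 2 / 4)) * v ξ ^ 2) := by
  intro k C_B
  obtain ⟨C, hC0, hC⟩ := biotSavart2D_gauss_mul_sq_integral_le (2 * k + 2)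
  refine ⟨Real.sqrt (8 * Real.pi * C_B ^ 2 * C), Real.sqrt_nonneg _, ?_⟩
  rintro wB a v hgwB hwBg ha hv ⟨A, hA⟩
  have hGpos : ∀ ξ : EuclideanSpace ℝ (Fin 2), 0 < gaussVortexProfile ξ := gaussVortexProfile_pos
  have hGc : Continuous gaussVortexProfile := (contDiff_gaussVortexProfile (n := 0)).continuous
  have hΩc : Continuous fun ξ : EuclideanSpace ℝ (Fin 2) => (8 * Real.pi)⁻¹ * burgersPhi (‖ξ‖ ^ 2 / 4) :=
    continuous_const.mul ((contDiff_burgersPhi (n := 0)).continuous.comp ((continuous_norm.pow 2).div_const 4))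
  have hΩ0 : ∀ ξ : EuclideanSpace ℝ (Fin 2), 0 < (8 * Real.pi)⁻¹ * burgersPhi (‖ξ‖ ^ 2 / 4) := fun ξ =>
    mul_pos (by positivity) (burgersPhi_pos _)
  have hΩ1 : ∀ ξ : EuclideanSpace ℝ (Fin 2), (8 * Real.pi)⁻¹ * burgersPhi (‖ξ‖ ^ 2 / 4) ≤ (8 * Real.pi)⁻¹ :=
    fun ξ => mul_le_of_le_one_right (by positivity) (burgersPhi_le_one (by positivity))
  obtain ⟨hpi, hple⟩ := hC v hv ⟨A, fun ξ => (hA ξ).2⟩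
  -- `q = G Ω a²` is integrable
  have hQ0 : ∀ ξ : EuclideanSpace ℝ (Fin 2),
      0 ≤ gaussVortexProfile ξ * ((8 * Real.pi)⁻¹ * burgersPhi (‖ξ‖ ^ 2 / 4)) * a ξ ^ 2 := fun ξ =>
    mul_nonneg (mul_nonneg (hGpos ξ).le (hΩ0 ξ).le) (sq_nonneg _)
  have hq : Integrable fun ξ => gaussVortexProfile ξ * ((8 * Real.pi)⁻¹ * burgersPhi (‖ξ‖ ^ 2 / 4)) * a ξ ^ 2 := by
    refine integrable_of_le_one_add_norm_pow_mul_gauss ((hGc.mul hΩc).mul (ha.pow 2))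
      (A := (8 * Real.pi)⁻¹ * A ^ 2) (N := 0) fun ξ => ?_
    rw [Real.norm_of_nonneg (hQ0 ξ), pow_zero, one_mul]
    have ha2 : a ξ ^ 2 ≤ A ^ 2 := by rw [← sq_abs]; exact pow_le_pow_left₀ (abs_nonneg _) (hA ξ).1 2
    have h1 := mul_le_mul (hΩ1 ξ) ha2 (sq_nonneg _) (by positivity : (0:ℝ) ≤ (8 * Real.pi)⁻¹)
    calc gaussVortexProfile ξ * ((8 * Real.pi)⁻¹ * burgersPhi (‖ξ‖ ^ 2 / 4)) * a ξ ^ 2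
        = gaussVortexProfile ξ * ((8 * Real.pi)⁻¹ * burgersPhi (‖ξ‖ ^ 2 / 4) * a ξ ^ 2) := by ring
      _ ≤ gaussVortexProfile ξ * ((8 * Real.pi)⁻¹ * A ^ 2) := mul_le_mul_of_nonneg_left h1 (hGpos ξ).le
      _ = (8 * Real.pi)⁻¹ * A ^ 2 * gaussVortexProfile ξ := by ring
  -- measurability of the pairing
  have hrm : AEStronglyMeasurable
      (fun ξ => a ξ * ⟪biotSavart2D (fun η => gaussVortexProfile η * v η) ξ, gradient wB ξ⟫) volume :=
    ha.aestronglyMeasurable.mul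
      ((stronglyMeasurable_biotSavart2D (hGc.mul hv).measurable).aestronglyMeasurable.inner hgwB.aestronglyMeasurable)
  -- Cauchy–Schwarz with `p = 8πC_B² ‖K∗(Gv)‖² (1+|ξ|)^{2k+2} G`, `q = G Ω a²`
  have hCS := integrable_and_abs_integral_le_of_sq_le_mul hrm (hpi.const_mul (8 * Real.pi * C_B ^ 2)) hq
    (fun ξ => mul_nonneg (by positivity) (mul_nonneg (sq_nonneg _) (mul_nonneg (by positivity) (hGpos ξ).le)))
    hQ0 (fun ξ => by
      have hX : |⟪biotSavart2D (fun η => gaussVortexProfile η * v η) ξ, gradient wB ξ⟫| ≤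
          ‖biotSavart2D (fun η => gaussVortexProfile η * v η) ξ‖ * (C_B * (1 + ‖ξ‖) ^ k * gaussVortexProfile ξ) :=
        (abs_real_inner_le_norm _ _).trans (mul_le_mul_of_nonneg_left (hwBg ξ) (norm_nonneg _))
      have hX2 : ⟪biotSavart2D (fun η => gaussVortexProfile η * v η) ξ, gradient wB ξ⟫ ^ 2 ≤
          (‖biotSavart2D (fun η => gaussVortexProfile η * v η) ξ‖ * (C_B * (1 + ‖ξ‖) ^ k * gaussVortexProfile ξ)) ^ 2 := by
        have := pow_le_pow_left₀ (abs_nonneg _) hX 2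
        rwa [sq_abs] at this
      calc (a ξ * ⟪biotSavart2D (fun η => gaussVortexProfile η * v η) ξ, gradient wB ξ⟫) ^ 2
          = a ξ ^ 2 * ⟪biotSavart2D (fun η => gaussVortexProfile η * v η) ξ, gradient wB ξ⟫ ^ 2 := by ring
        _ ≤ a ξ ^ 2 * (‖biotSavart2D (fun η => gaussVortexProfile η * v η) ξ‖ *
              (C_B * (1 + ‖ξ‖) ^ k * gaussVortexProfile ξ)) ^ 2 := mul_le_mul_of_nonneg_left hX2 (sq_nonneg _)
        _ ≤ a ξ ^ 2 * (‖biotSavart2D (fun η => gaussVortexProfile η * v η) ξ‖ *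
              (C_B * (1 + ‖ξ‖) ^ k * gaussVortexProfile ξ)) ^ 2 *
              (8 * Real.pi * (1 + ‖ξ‖) ^ 2 * ((8 * Real.pi)⁻¹ * burgersPhi (‖ξ‖ ^ 2 / 4))) :=
            le_mul_of_one_le_right (by positivity) (one_le_mul_sq_mul_omegaWeight ξ)
        _ = 8 * Real.pi * C_B ^ 2 * (‖biotSavart2D (fun η => gaussVortexProfile η * v η) ξ‖ ^ 2 *
              ((1 + ‖ξ‖) ^ (2 * k + 2) * gaussVortexProfile ξ)) *
              (gaussVortexProfile ξ * ((8 * Real.pi)⁻¹ * burgersPhi (‖ξ‖ ^ 2 / 4)) * a ξ ^ 2) := by ring)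
  rw [integral_const_mul] at hCS
  refine ⟨hCS.1, hCS.2.trans ?_⟩
  have hple' := mul_le_mul_of_nonneg_left hple (by positivity : (0:ℝ) ≤ 8 * Real.pi * C_B ^ 2)
  rw [← mul_assoc] at hple'
  calc Real.sqrt (8 * Real.pi * C_B ^ 2 * ∫ ξ, ‖biotSavart2D (fun η => gaussVortexProfile η * v η) ξ‖ ^ 2 *
            ((1 + ‖ξ‖) ^ (2 * k + 2) * gaussVortexProfile ξ)) *
          Real.sqrt (∫ ξ, gaussVortexProfile ξ * ((8 * Real.pi)⁻¹ * burgersPhi (‖ξ‖ ^ 2 / 4)) * a ξ ^ 2)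
      ≤ Real.sqrt (8 * Real.pi * C_B ^ 2 * C *
            ∫ ξ, gaussVortexProfile ξ * ((8 * Real.pi)⁻¹ * burgersPhi (‖ξ‖ ^ 2 / 4)) * v ξ ^ 2) *
          Real.sqrt (∫ ξ, gaussVortexProfile ξ * ((8 * Real.pi)⁻¹ * burgersPhi (‖ξ‖ ^ 2 / 4)) * a ξ ^ 2) :=
        mul_le_mul_of_nonneg_right (Real.sqrt_le_sqrt hple') (Real.sqrt_nonneg _)
    _ = _ := by rw [Real.sqrt_mul (by positivity)]; ring

end Summit.AnomalousDissipation.AnomalousDissipation.Theorems.MarginalStabilityChainStretchedVortexRows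

end
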